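import Literature.Analysis.OperatorTheory.LpDilation
import Mathlib.MeasureTheory.Function.ContinuousMapDense
import Mathlib.Topology.UniformSpace.UniformApproximation
import HarnessLib

/-!
# Strong continuity of dilations on `L^p` (the dilation group acts continuously)

Analysis/OperatorTheory proofs-layer file (theorems only, no definitions, no named facts),
continuing `LpDilation.lean`: for `f ∈ L^p(V; F)`, `1 ≤ p < ∞`, and a continuous nowhere-zero
scale `a : ℝ → ℝ`, the map `τ ↦ D_{a(τ)} f = f(a(τ) ·)` is continuous into `L^p` — the dilation
analogue of the continuity of translations in `L^p`. Proof as in Stein–Weiss, Ch. I §1: for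
`g` continuous with compact support, `g(a ·) → g(a₀ ·)` uniformly with supports in a fixed ball,
hence in `L^p` (`tendsto_eLpNorm_comp_smul_sub`); general `f` by density of such `g` in `L^p`
(`MemLp.exists_hasCompactSupport_eLpNorm_sub_le`) and the locally uniform bound
`‖D_a‖ = |a|^{−d/p}` (`continuous_lpDilation_apply`). This is the strong-continuity input for
the similarity heat semigroup (`SimilarityHeatSemigroupFourier.lean`).

## References

* E. M. Stein, G. Weiss, *Introduction to Fourier Analysis on Euclidean Spaces* (1971), Ch. I §1.
  [SteinWeiss1971]
-/

noncomputable section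

open MeasureTheory Filter Topology Metric Set
open scoped ENNReal NNReal

namespace Literature.Analysis.OperatorTheory

variable {V : Type*} [NormedAddCommGroup V] [InnerProductSpace ℝ V] [FiniteDimensional ℝ V]
  [MeasurableSpace V] [BorelSpace V]
variable {F : Type*} [NormedAddCommGroup F]

/-- **Dilations of a continuous compactly supported function vary continuously in `L^p`**:
`‖g(a ·) − g(a₀ ·)‖_p → 0` as `a → a₀ ≠ 0`. [cite: SteinWeiss1971, Ch. I §1] -/
theorem tendsto_eLpNorm_comp_smul_sub {g : V → F} (hg : Continuous g) (hsupp : HasCompactSupport g)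
    {a₀ : ℝ} (ha₀ : a₀ ≠ 0) (p : ℝ≥0∞) :
    Tendsto (fun a : ℝ => eLpNorm (fun x => g (a • x) - g (a₀ • x)) p (volume : Measure V))
      (𝓝 a₀) (𝓝 0) := by
  -- the support of `g` lies in a ball of radius `R > 0`
  obtain ⟨R, hR0, hR⟩ := hsupp.isCompact.isBounded.subset_closedBall_lt 0 (0 : V)
  have hg0 : ∀ y : V, R < ‖y‖ → g y = 0 := fun y hy =>
    image_eq_zero_of_notMem_tsupport fun h => by
      have := hR h
      rw [mem_closedBall, dist_zero_right] at this
      linarith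
  -- the big ball containing all supports for `|a| > |a₀|/2`
  set ρ : ℝ := 2 * R / |a₀| with hρ
  have ha₀' : 0 < |a₀| := abs_pos.2 ha₀
  have hρ0 : 0 < ρ := by rw [hρ]; positivity
  set K : Set V := closedBall (0 : V) ρ with hK
  have hKfin : (volume : Measure V) K < ∞ := measure_closedBall_lt_top
  -- supports
  have hsupp_a : ∀ a : ℝ, |a₀| / 2 < |a| → ∀ x : V, x ∉ K → g (a • x) - g (a₀ • x) = 0 := by
    intro a ha x hx
    rw [hK, mem_closedBall, dist_zero_right, not_le] at hx
    have h1 : R < ‖a • x‖ := by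
      rw [norm_smul, Real.norm_eq_abs]
      calc R = |a₀| / 2 * ρ := by rw [hρ]; field_simp
        _ < |a| * ‖x‖ := by
          apply mul_lt_mul ha hx.le hρ0 (abs_nonneg a)
    have h2 : R < ‖a₀ • x‖ := by
      rw [norm_smul, Real.norm_eq_abs]
      calc R < 2 * R := by linarith
        _ = |a₀| * ρ := by rw [hρ]; field_simp
        _ < |a₀| * ‖x‖ := mul_lt_mul_of_pos_left hx ha₀'
    rw [hg0 _ h1, hg0 _ h2, sub_zero]
  -- uniform continuity of `g`
  have hunif : UniformContinuous g := hsupp.uniformContinuous_of_continuous hg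
  rw [ENNReal.tendsto_nhds_zero]
  intro ε' hε'
  -- choose a real `ε > 0` with `vol(K)^{1/p} · ε ≤ ε'`
  have hCfin : (volume : Measure V) K ^ p.toReal⁻¹ ≠ ∞ :=
    ENNReal.rpow_ne_top_of_nonneg (by positivity) hKfin.ne
  obtain ⟨ε, hε, hεpos⟩ : ∃ ε : ℝ, (volume : Measure V) K ^ p.toReal⁻¹ * ENNReal.ofReal ε ≤ ε' ∧
      0 < ε := by
    have ht : Tendsto (fun ε : ℝ => (volume : Measure V) K ^ p.toReal⁻¹ * ENNReal.ofReal ε)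
        (𝓝[>] 0) (𝓝 0) := by
      have h0 : Tendsto (fun ε : ℝ => ENNReal.ofReal ε) (𝓝 0) (𝓝 0) := by
        simpa using ENNReal.tendsto_ofReal (tendsto_id (x := 𝓝 (0 : ℝ)))
      have h1 := ENNReal.Tendsto.const_mul h0 (Or.inr hCfin)
      rw [mul_zero] at h1
      exact h1.mono_left nhdsWithin_le_nhds
    obtain ⟨ε, h1, h2⟩ := ((ht.eventually (ge_mem_nhds hε')).and self_mem_nhdsWithin).exists
    exact ⟨ε, h1, h2⟩
  obtain ⟨η, hη, hηg⟩ := Metric.uniformContinuous_iff.1 hunif ε hεpos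
  -- for `a` close to `a₀`: `|a| > |a₀|/2` and `|a − a₀| ρ < η`
  have hnear : ∀ᶠ a : ℝ in 𝓝 a₀, |a₀| / 2 < |a| ∧ |a - a₀| * ρ < η := by
    refine Filter.Eventually.and ?_ ?_
    · exact (continuous_abs.tendsto a₀).eventually (lt_mem_nhds (by linarith))
    · have : Tendsto (fun a : ℝ => |a - a₀| * ρ) (𝓝 a₀) (𝓝 (|a₀ - a₀| * ρ)) :=
        ((continuous_id.sub continuous_const).abs.mul continuous_const).tendsto a₀
      rw [sub_self, abs_zero, zero_mul] at this
      exact this.eventually (gt_mem_nhds hη)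
  filter_upwards [hnear] with a ha
  -- pointwise bound `‖g(a x) − g(a₀ x)‖ ≤ ε` everywhere
  have hpt : ∀ x : V, ‖g (a • x) - g (a₀ • x)‖ ≤ ε := by
    intro x
    by_cases hx : x ∈ K
    · rw [← dist_eq_norm]
      refine le_of_lt (hηg ?_)
      rw [dist_eq_norm, ← sub_smul, norm_smul, Real.norm_eq_abs]
      rw [hK, mem_closedBall, dist_zero_right] at hx
      calc |a - a₀| * ‖x‖ ≤ |a - a₀| * ρ := mul_le_mul_of_nonneg_left hx (abs_nonneg _)
        _ < η := ha.2
    · rw [hsupp_a a ha.1 x hx, norm_zero]; exact hεpos.le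
  -- restrict to `K` and bound
  have hsub : (Function.support fun x => g (a • x) - g (a₀ • x)) ⊆ K := by
    intro x hx
    by_contra hxK
    exact hx (hsupp_a a ha.1 x hxK)
  rw [← eLpNorm_restrict_eq_of_support_subset hsub]
  refine (eLpNorm_le_of_ae_bound (Eventually.of_forall hpt)).trans ?_
  rw [Measure.restrict_apply_univ]
  exact hε

variable [NormedSpace ℂ F] {p : ℝ≥0∞} [Fact (1 ≤ p)]

/-- For `g` continuous with compact support (as an element of `L^p`), `τ ↦ D_{a(τ)} g` is
continuous for any continuous nowhere-vanishing scale `a`. [cite: SteinWeiss1971, Ch. I §1] -/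
theorem continuous_lpDilation_apply_of_continuous_hasCompactSupport (hp : p ≠ ∞) {g : V → F}
    (hg : Continuous g) (hsupp : HasCompactSupport g) (hgp : MemLp g p (volume : Measure V))
    {a : ℝ → ℝ} (ha : Continuous a) (ha0 : ∀ τ, a τ ≠ 0) :
    Continuous fun τ : ℝ => lpDilation (a τ) (ha0 τ) hp (hgp.toLp g) := by
  refine continuous_iff_continuousAt.2 fun τ₀ => ?_
  rw [ContinuousAt, tendsto_iff_norm_sub_tendsto_zero]
  have hlim := ((tendsto_eLpNorm_comp_smul_sub hg hsupp (ha0 τ₀) p).comp (ha.tendsto τ₀))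
  -- `‖D_{a τ} g − D_{a τ₀} g‖ = (eLpNorm (g(a τ ·) − g(a τ₀ ·)) p).toReal`
  have heq : ∀ τ : ℝ, ‖lpDilation (a τ) (ha0 τ) hp (hgp.toLp g) -
      lpDilation (a τ₀) (ha0 τ₀) hp (hgp.toLp g)‖ =
      (eLpNorm (fun x => g (a τ • x) - g (a τ₀ • x)) p (volume : Measure V)).toReal := by
    intro τ
    rw [Lp.norm_def]
    congr 1
    refine eLpNorm_congr_ae ?_
    filter_upwards [Lp.coeFn_sub (lpDilation (a τ) (ha0 τ) hp (hgp.toLp g))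
        (lpDilation (a τ₀) (ha0 τ₀) hp (hgp.toLp g)),
      lpDilation_coeFn (ha0 τ) hp (hgp.toLp g), lpDilation_coeFn (ha0 τ₀) hp (hgp.toLp g),
      ae_eq_comp_smul (MemLp.coeFn_toLp hgp) (ha0 τ),
      ae_eq_comp_smul (MemLp.coeFn_toLp hgp) (ha0 τ₀)] with x h1 h2 h3 h4 h5
    rw [h1, Pi.sub_apply, h2, h3, h4, h5]
  simp_rw [heq]
  rw [← ENNReal.toReal_zero]
  exact (ENNReal.tendsto_toReal ENNReal.zero_ne_top).comp hlim

/-- **Strong continuity of dilations**: for every `f ∈ L^p(V; F)` (`1 ≤ p < ∞`) and every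
continuous nowhere-vanishing scale `a : ℝ → ℝ`, `τ ↦ D_{a(τ)} f` is continuous (density of
`C_c` in `L^p` and the locally uniform bound `‖D_a‖ = |a|^{−d/p}`). [cite: SteinWeiss1971, Ch. I §1] -/
theorem continuous_lpDilation_apply (hp : p ≠ ∞) (f : Lp F p (volume : Measure V)) {a : ℝ → ℝ}
    (ha : Continuous a) (ha0 : ∀ τ, a τ ≠ 0) :
    Continuous fun τ : ℝ => lpDilation (a τ) (ha0 τ) hp f := by
  refine continuous_of_locally_uniform_approx_of_continuousAt fun τ₀ u hu => ?_
  obtain ⟨ε, hε, hεu⟩ := Metric.mem_uniformity_dist.1 hu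
  -- the dilation factor `c(τ) = ‖D_{a τ}‖` is continuous in `τ`, hence `≤ c(τ₀) + 1` near `τ₀`
  set c : ℝ → ℝ := fun τ =>
    (ENNReal.ofReal |((a τ) ^ Module.finrank ℝ V)⁻¹| ^ (1 / p).toReal).toReal with hc
  have hc_cont : Continuous c := by
    have h1 : Continuous fun τ => |((a τ) ^ Module.finrank ℝ V)⁻¹| :=
      ((ha.pow _).inv₀ fun τ => pow_ne_zero _ (ha0 τ)).abs
    have h2 : ∀ τ, c τ = |((a τ) ^ Module.finrank ℝ V)⁻¹| ^ (1 / p).toReal := by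
      intro τ
      show (ENNReal.ofReal |((a τ) ^ Module.finrank ℝ V)⁻¹| ^ (1 / p).toReal).toReal = _
      rw [← ENNReal.toReal_rpow, ENNReal.toReal_ofReal (abs_nonneg _)]
    have h3 : c = fun τ => |((a τ) ^ Module.finrank ℝ V)⁻¹| ^ (1 / p).toReal := funext h2
    rw [h3]
    exact h1.rpow_const fun τ => Or.inl (abs_pos.2 (inv_ne_zero (pow_ne_zero _ (ha0 τ)))).ne'
  have hnear : ∀ᶠ τ in 𝓝 τ₀, c τ < c τ₀ + 1 :=
    (hc_cont.tendsto τ₀).eventually (gt_mem_nhds (by linarith))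
  -- approximate `f` by a continuous compactly supported `g` within `δ = ε / (2 (c τ₀ + 1))`
  have hc0 : 0 ≤ c τ₀ := ENNReal.toReal_nonneg
  set δ : ℝ := ε / (2 * (c τ₀ + 1)) with hδ
  have hδ0 : 0 < δ := by rw [hδ]; positivity
  obtain ⟨g, hgsupp, hgf, hgc, hgp⟩ := (Lp.memLp f).exists_hasCompactSupport_eLpNorm_sub_le hp
    (ENNReal.ofReal_pos.2 hδ0).ne'
  refine ⟨{τ | c τ < c τ₀ + 1}, hnear, fun τ => lpDilation (a τ) (ha0 τ) hp (hgp.toLp g),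
    (continuous_lpDilation_apply_of_continuous_hasCompactSupport hp hgc hgsupp hgp ha
      ha0).continuousAt, fun τ hτ => hεu ?_⟩
  -- `dist (D f) (D g) = ‖D (f − g)‖ ≤ c τ · ‖f − g‖ < (c τ₀ + 1) δ < ε`
  rw [dist_eq_norm, ← map_sub, norm_lpDilation_apply]
  have hfg : ‖f - hgp.toLp g‖ ≤ δ := by
    rw [Lp.norm_def]
    have h1 : eLpNorm ((f : V → F) - g) p volume = eLpNorm (⇑(f - hgp.toLp g)) p volume := by
      refine eLpNorm_congr_ae ?_
      filter_upwards [Lp.coeFn_sub f (hgp.toLp g), MemLp.coeFn_toLp hgp] with x h1 h2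
      rw [h1, Pi.sub_apply, Pi.sub_apply, h2]
    rw [← h1]
    have := ENNReal.toReal_mono ENNReal.ofReal_ne_top hgf
    rwa [ENNReal.toReal_ofReal hδ0.le] at this
  calc c τ * ‖f - hgp.toLp g‖ ≤ (c τ₀ + 1) * δ :=
        mul_le_mul (le_of_lt hτ) hfg (norm_nonneg _) (by linarith)
    _ = ε / 2 := by rw [hδ]; field_simp
    _ < ε := by linarith

end Literature.Analysis.OperatorTheory
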